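import Mathlib.LinearAlgebra.FiniteDimensional.Lemmas
import Mathlib.LinearAlgebra.Dimension.Constructions
import Mathlib.Topology.Algebra.OpenSubgroup
import Literature.AnabelianGeometry.AbsoluteAnabelian.CoinvariantRankLowerBoundProofs
import HarnessLib

/-!
# `δ¹_p(V′) ≤ δ¹_p(V) + δ¹_p(M)` for `V = V′·⟨σ⟩` with `[σ, V′] ⊆ M` — the key rank lemma of the
# elasticity criterion ([AbsTopI] Thm 1.7 (ii) route, GAP row G-w5d206-1)

S. Mochizuki, *Topics in Absolute Anabelian Geometry I: Generalities* (2012) [AbsTopI] (lit key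
`paper:url-11ac98ba15fc`), Thm 1.7 (ii) p. 14: "If `k` is an MLF, then `G_k` [...] is elastic"
(Def 1.1 (ii) p. 10).  The abc-iut cell discharges the tree's predicate `IsElastic (G_k)` by an
ELEMENTARY RANK ARGUMENT over the landed rank formula `δ¹_p(U) = [k_U : ℚ_p] + 1` (GAP-LEDGER row
G-w5d206-1; plan abc-iut-L4-t16 g3, STATUS 2026-08-26T01:40:43Z; criterion file (2)
`ProfiniteElasticCriterionProofs.lean`, abc-iut-L4-t15 g3, which carries the present lemma as its
explicit hypothesis `hKey`).  HONEST CAVEAT: this is NOT the printed route of [AbsTopI] Thm 1.7 (ii)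
(free pro-`p` structure of maximal pro-`p` quotients); it is an independent argument for the typed
predicate — establishment here means OUR kernel check.

THIS PROOF-ONLY FILE (no definitions, no named facts) proves the KEY RANK LEMMA for a compact
topological group `Γ`: if `V′ ⊆ V ⊆ Γ` are subgroups with `V′` open, `V′ ⊴ V`, `V = V′·⟨σ⟩`, and
`M ⊆ V′` is a CLOSED subgroup containing every commutator `σ v σ⁻¹ v⁻¹` (`v ∈ V′`), then

  `δ¹_p(V′) ≤ δ¹_p(V) + δ¹_p(M)`                    (`freeProlRank_le_add_of_sup_zpowers`).

PROOF.  Let `N ≤ δ¹_p(V′)`; the tree's dictionary (`FreeProlRankLinearProofs`) gives `N` continuous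
characters `φ_i : V′ → ℤ_p`, linearly independent over `ℚ_p`.  Rank–nullity for the restriction of
their `ℚ_p`-span to `M` splits `N = k + r`: `r` independent `ℚ_p`-combinations of the `φ_i|_M`
(after clearing denominators, `r` independent characters of the compact group `M`, so
`r ≤ δ¹_p(M)`), and `k` independent combinations `w_t` VANISHING ON `M`.  Since `M ∋ σvσ⁻¹v⁻¹`,
each `w_t` is `σ`-INVARIANT, hence invariant under conjugation by all of `V = V′·⟨σ⟩`; by the
tree's transfer lemma (`exists_extension_pow_index`, [AbsAnab] Lemma 1.1.4 (ii) machinery, applied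
to `V′ ⊴ V` with the trivial retraction) `[V : V′] · w_t` extends to a continuous character of `V`,
and the extensions stay independent, so `k ≤ δ¹_p(V)`.

Consumed BY NAME by abc-iut-L4-t15's `isElastic_of_freeProlRank_open_eq` (there `M = N ∩ U₀`, closed).
Classical profinite group theory; nothing here bears on [IUTchIII] Cor. 3.12.
-/

noncomputable section

open Topology Module

universe u

namespace Literature.AnabelianGeometry.AbsoluteAnabelian

/-! ### Linear algebra: kernel and range of a restriction map (rank–nullity) -/

/-- Rank–nullity for the restriction of the span of `N` independent functions `u_i : X → K` along
`ι : Y → X`: `N = k + r` with `k` independent combinations vanishing on `ι(Y)` and `r` independent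
combinations of the restrictions `u_i ∘ ι` (adapted from `CoinvariantRankProofs`).
[cite: MochizukiAbsAnab2004, Lemma 1.1.4 (ii) proof p.8] -/
private theorem exists_kernel_range_families {K : Type*} [Field K] {X Y : Type*} (ι : Y → X)
    {N : ℕ} (u : Fin N → (X → K)) (hu : LinearIndependent K u) :
    ∃ (k r : ℕ) (w : Fin k → (X → K)) (cw : Fin k → Fin N → K)
      (z : Fin r → (Y → K)) (cz : Fin r → Fin N → K),
      N = k + r ∧ LinearIndependent K w ∧ (∀ t, ∑ i, cw t i • u i = w t) ∧
        (∀ t y, w t (ι y) = 0) ∧ LinearIndependent K z ∧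
        (∀ j y, ∑ i, cz j i * u i (ι y) = z j y) := by
  classical
  -- the restriction map in coordinates: `F c = (Σ c_i u_i)|_Y`
  obtain ⟨F, hF⟩ : ∃ F : (Fin N → K) →ₗ[K] (Y → K),
      ∀ (c : Fin N → K) (d : Y), F c d = ∑ i, c i * u i (ι d) :=
    ⟨(LinearMap.funLeft K K ι).comp (Fintype.linearCombination K u), fun c d => by
      simp [Fintype.linearCombination_apply, Finset.sum_apply, smul_eq_mul]⟩
  have hrn := LinearMap.finrank_range_add_finrank_ker F
  rw [Module.finrank_fin_fun] at hrn
  obtain ⟨k, hk⟩ : ∃ k, Module.finrank K (LinearMap.ker F) = k := ⟨_, rfl⟩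
  obtain ⟨r, hr⟩ : ∃ r, Module.finrank K (LinearMap.range F) = r := ⟨_, rfl⟩
  let b := Module.finBasis K (LinearMap.ker F)
  let b' := Module.finBasis K (LinearMap.range F)
  have hcz : ∀ j : Fin r, ∃ c : Fin N → K, F c = (b' (Fin.cast hr.symm j) : Y → K) :=
    fun j => (b' (Fin.cast hr.symm j)).2
  choose cz hcz using hcz
  refine ⟨k, r, fun t => ∑ i, (b (Fin.cast hk.symm t) : Fin N → K) i • u i,
    fun t => (b (Fin.cast hk.symm t) : Fin N → K),
    fun j => (b' (Fin.cast hr.symm j) : Y → K), cz, by omega, ?_, fun t => rfl, ?_, ?_, ?_⟩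
  · -- independence of the kernel family
    have hinj : LinearMap.ker (Fintype.linearCombination K u) = ⊥ :=
      LinearMap.ker_eq_bot.mpr ((linearIndependent_iff_injective_fintypeLinearCombination).mp hu)
    have h1 := b.linearIndependent
    have h2 : LinearIndependent K (fun t => ((b t : LinearMap.ker F) : Fin N → K)) :=
      h1.map' (LinearMap.ker F).subtype (Submodule.ker_subtype _)
    have h3 := h2.map' (Fintype.linearCombination K u) hinj
    have h4 := h3.comp (Fin.cast hk.symm) (Fin.cast_injective _)
    have heq : (fun t => ∑ i, (b (Fin.cast hk.symm t) : Fin N → K) i • u i) =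
        ((⇑(Fintype.linearCombination K u) ∘ fun t => ((b t : LinearMap.ker F) : Fin N → K)) ∘
          Fin.cast hk.symm) := by
      funext t
      simp [Fintype.linearCombination_apply]
    rw [heq]
    exact h4
  · -- vanishing on `Y`
    intro t d
    have hmem : F (b (Fin.cast hk.symm t) : Fin N → K) = 0 := (b (Fin.cast hk.symm t)).2
    have h2 := congrFun hmem d
    rw [hF] at h2
    simpa [Finset.sum_apply, smul_eq_mul] using h2
  · -- independence of the range family
    have h1 := b'.linearIndependent
    have h2 : LinearIndependent K (fun t => ((b' t : LinearMap.range F) : Y → K)) :=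
      h1.map' (LinearMap.range F).subtype (Submodule.ker_subtype _)
    exact h2.comp (Fin.cast hr.symm) (Fin.cast_injective _)
  · -- the range family in coordinates
    intro j y
    rw [← hF, hcz j]

/-! ### The key rank lemma -/

variable {Γ : Type u} [Group Γ] [TopologicalSpace Γ] [IsTopologicalGroup Γ] [CompactSpace Γ]

/-- **Key rank lemma** (`hKey` of the elasticity criterion): let `Γ` be a compact topological
group, `V′ ≤ V ≤ Γ` subgroups with `V′` open and normal in `V`, `σ ∈ V` with `V = V′ ⊔ ⟨σ⟩`, and
`M ≤ V′` a closed subgroup containing `σ v σ⁻¹ v⁻¹` for every `v ∈ V′`.  Then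
`δ¹_p(V′) ≤ δ¹_p(V) + δ¹_p(M)`: characters of `V′` killing `M` are `σ`-invariant and extend
(times `[V : V′]`, via the transfer) to `V`; the others restrict to independent characters of `M`.
Independent argument for the typed elasticity of `G_k` ([AbsTopI] Thm 1.7 (ii) — NOT the printed
pro-`p` route). [cite: MochizukiAbsTopI2012, Thm 1.7 (ii) p.14] -/
theorem freeProlRank_le_add_of_sup_zpowers (p : ℕ) [Fact p.Prime]
    (V V' M : Subgroup Γ) (σ : Γ) (hV'o : IsOpen (V' : Set Γ)) (hV'V : V' ≤ V) (hMV' : M ≤ V')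
    (hσV : σ ∈ V) (hgen : V' ⊔ Subgroup.zpowers σ = V) (hV'n : (V'.subgroupOf V).Normal)
    (hcomm : ∀ v ∈ V', σ * v * σ⁻¹ * v⁻¹ ∈ M) (hMc : IsClosed (M : Set Γ)) :
    freeProlRank V' p ≤ freeProlRank V p + freeProlRank M p := by
  classical
  -- topology: `V ⊇ V′` is open, hence closed; `V`, `V′`, `M` are compact
  have hVo : IsOpen (V : Set Γ) := Subgroup.isOpen_mono hV'V hV'o
  have hVc : IsClosed (V : Set Γ) := Subgroup.isClosed_of_isOpen V hVo
  haveI : CompactSpace V := isCompact_iff_compactSpace.mp hVc.isCompact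
  haveI : CompactSpace V' :=
    isCompact_iff_compactSpace.mp (Subgroup.isClosed_of_isOpen V' hV'o).isCompact
  haveI : CompactSpace M := isCompact_iff_compactSpace.mp hMc.isCompact
  -- conjugation by `V` preserves `V′`
  have hconjV' : ∀ g ∈ V, ∀ d ∈ V', g * d * g⁻¹ ∈ V' := by
    intro g hg d hd
    have h := hV'n.conj_mem ⟨d, hV'V hd⟩ (by simpa [Subgroup.mem_subgroupOf] using hd) ⟨g, hg⟩
    simpa [Subgroup.mem_subgroupOf] using h
  -- `V′` as an open subgroup `D` of the compact group `V`
  set D : Subgroup V := V'.subgroupOf V with hDdef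
  haveI hDn : D.Normal := hV'n
  have hDo : IsOpen (D : Set V) := by
    change IsOpen (((↑) : V → Γ) ⁻¹' (V' : Set Γ))
    exact hV'o.preimage continuous_subtype_val
  haveI : D.FiniteIndex := by
    haveI : Finite (V ⧸ D) := Subgroup.quotient_finite_of_isOpen D hDo
    exact Subgroup.finiteIndex_of_finite_quotient
  have hf0 : (D.index : ℚ_[p]) ≠ 0 := by exact_mod_cast Subgroup.FiniteIndex.index_ne_zero
  -- the transport `D ≅ V′`
  let e : D →ₜ* V' :=
    ⟨(Subgroup.subgroupOfEquivOfLe hV'V).toMonoidHom,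
      (continuous_subtype_val.comp continuous_subtype_val).subtype_mk _⟩
  have he : ∀ d : D, e d = ⟨((d : V) : Γ), Subgroup.mem_subgroupOf.mp d.2⟩ := fun d => rfl
  refine (ENat.forall_natCast_le_iff_le).mp fun N hN => ?_
  obtain ⟨Φ, hΦ⟩ := exists_linearIndependent_of_le_freeProlRank (H := V') p hN
  -- rank–nullity for the restriction of the span of the `Φ_i` to `M`
  let ι : M → V' := fun m => ⟨m, hMV' m.2⟩
  obtain ⟨k, r, w, cw, z, cz, hNkr, hw, hcw, hwM, hz, hcz⟩ :=
    exists_kernel_range_families (K := ℚ_[p]) ι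
      (fun i x => ((Multiplicative.toAdd (Φ i x) : ℤ_[p]) : ℚ_[p])) hΦ
  /- (B) `r ≤ δ¹_p(M)`: clear denominators in the range family -/
  have hrM : (r : ℕ∞) ≤ freeProlRank M p := by
    let ΦM : Fin N → (M →ₜ* Multiplicative ℤ_[p]) := fun i =>
      (Φ i).comp ⟨Subgroup.inclusion hMV', continuous_subtype_val.subtype_mk _⟩
    have hΦM : ∀ i m, ΦM i m = Φ i (ι m) := fun i m => rfl
    obtain ⟨bden, hbden, hint⟩ :=
      exists_integer_multiples_padic p (fun ji : Fin r × Fin N => cz ji.1 ji.2)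
    choose a ha using hint
    have hΘ : ∀ j, ∃ Θ : M →ₜ* Multiplicative ℤ_[p],
        ∀ m, Multiplicative.toAdd (Θ m) = ∑ i, a (j, i) * Multiplicative.toAdd (ΦM i m) :=
      fun j => exists_padicInt_combination p ΦM (fun i => a (j, i))
    choose Θ hΘ using hΘ
    have hΘz : ∀ j m, ((Multiplicative.toAdd (Θ j m) : ℤ_[p]) : ℚ_[p]) = bden * z j m := by
      intro j m
      rw [hΘ, ← hcz j]
      simp only [PadicInt.coe_sum, PadicInt.coe_mul, ha, hΦM, Finset.mul_sum, mul_assoc]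
    have hbq : (bden : ℚ_[p]) ≠ 0 := fun h => hbden (PadicInt.coe_eq_zero.mp h)
    have hΘind : LinearIndependent ℚ_[p]
        (fun (j : Fin r) (m : M) => ((Multiplicative.toAdd (Θ j m) : ℤ_[p]) : ℚ_[p])) := by
      have heq : (fun (j : Fin r) (m : M) => ((Multiplicative.toAdd (Θ j m) : ℤ_[p]) : ℚ_[p])) =
          fun j => (Units.mk0 (bden : ℚ_[p]) hbq) • z j := by
        funext j m
        rw [hΘz, Pi.smul_apply, Units.smul_mk0, smul_eq_mul]
      rw [heq]
      exact hz.units_smul fun _ => Units.mk0 (bden : ℚ_[p]) hbq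
    exact le_freeProlRank_of_linearIndependent (H := M) p Θ hΘind
  /- (A) `k ≤ δ¹_p(V)`: the kernel family is `V`-invariant and extends via the transfer -/
  have hkV : (k : ℕ∞) ≤ freeProlRank V p := by
    obtain ⟨bden, hbden, hint⟩ :=
      exists_integer_multiples_padic p (fun ti : Fin k × Fin N => cw ti.1 ti.2)
    choose a ha using hint
    have hΘ : ∀ t, ∃ Θ : V' →ₜ* Multiplicative ℤ_[p],
        ∀ x, Multiplicative.toAdd (Θ x) = ∑ i, a (t, i) * Multiplicative.toAdd (Φ i x) :=
      fun t => exists_padicInt_combination p Φ (fun i => a (t, i))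
    choose Θ hΘ using hΘ
    have hΘw : ∀ t x, ((Multiplicative.toAdd (Θ t x) : ℤ_[p]) : ℚ_[p]) = bden * w t x := by
      intro t x
      rw [hΘ, ← hcw t]
      simp only [PadicInt.coe_sum, PadicInt.coe_mul, ha, Finset.sum_apply, Pi.smul_apply,
        smul_eq_mul, Finset.mul_sum, mul_assoc]
    have hbq : (bden : ℚ_[p]) ≠ 0 := fun h => hbden (PadicInt.coe_eq_zero.mp h)
    -- `Θ_t` kills `M`
    have hΘM : ∀ t (m : Γ) (hm : m ∈ M), Θ t ⟨m, hMV' hm⟩ = 1 := by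
      intro t m hm
      have h1 : ((Multiplicative.toAdd (Θ t ⟨m, hMV' hm⟩) : ℤ_[p]) : ℚ_[p]) = 0 := by
        rw [hΘw, show w t ⟨m, hMV' hm⟩ = w t (ι ⟨m, hm⟩) from rfl, hwM t ⟨m, hm⟩, mul_zero]
      exact toAdd_eq_zero.mp (PadicInt.coe_eq_zero.mp h1)
    -- `Θ_t` is invariant under conjugation by every element of `V = V′ ⊔ ⟨σ⟩`
    have hinv : ∀ t, ∀ g (hg : g ∈ V) d (hd : d ∈ V'),
        Θ t ⟨g * d * g⁻¹, hconjV' g hg d hd⟩ = Θ t ⟨d, hd⟩ := by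
      intro t
      -- a total version of `Θ_t` on `Γ`
      let T : Γ → ℤ_[p] := fun x => if hx : x ∈ V' then Multiplicative.toAdd (Θ t ⟨x, hx⟩) else 0
      have hT : ∀ x (hx : x ∈ V'), T x = Multiplicative.toAdd (Θ t ⟨x, hx⟩) :=
        fun x hx => dif_pos hx
      -- the elements of `V` conjugation by which fixes `T` on `V′` form a subgroup
      let S : Subgroup Γ :=
        { carrier := {g | g ∈ V ∧ ∀ d ∈ V', T (g * d * g⁻¹) = T d}
          one_mem' := ⟨V.one_mem, fun d _ => by simp⟩
          mul_mem' := by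
            rintro g h ⟨hgV, hg⟩ ⟨hhV, hh⟩
            refine ⟨V.mul_mem hgV hhV, fun d hd => ?_⟩
            rw [show g * h * d * (g * h)⁻¹ = g * (h * d * h⁻¹) * g⁻¹ by group,
              hg _ (hconjV' h hhV d hd), hh d hd]
          inv_mem' := by
            rintro g ⟨hgV, hg⟩
            refine ⟨V.inv_mem hgV, fun d hd => ?_⟩
            have h1 := hg _ (hconjV' g⁻¹ (V.inv_mem hgV) d hd)
            rw [show g * (g⁻¹ * d * g⁻¹⁻¹) * g⁻¹ = d by group] at h1
            exact h1.symm }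
      have hV'S : V' ≤ S := by
        intro d₀ hd₀
        refine ⟨hV'V hd₀, fun d hd => ?_⟩
        have hmem : d₀ * d * d₀⁻¹ ∈ V' := V'.mul_mem (V'.mul_mem hd₀ hd) (V'.inv_mem hd₀)
        rw [hT _ hmem, hT _ hd]
        have : (⟨d₀ * d * d₀⁻¹, hmem⟩ : V') = ⟨d₀, hd₀⟩ * ⟨d, hd⟩ * ⟨d₀, hd₀⟩⁻¹ := rfl
        rw [this, map_mul (Θ t), map_mul (Θ t), map_inv (Θ t), mul_inv_cancel_comm]
      have hσS : σ ∈ S := by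
        refine ⟨hσV, fun d hd => ?_⟩
        have hmem : σ * d * σ⁻¹ ∈ V' := hconjV' σ hσV d hd
        rw [hT _ hmem, hT _ hd]
        have : (⟨σ * d * σ⁻¹, hmem⟩ : V') =
            ⟨σ * d * σ⁻¹ * d⁻¹, hMV' (hcomm d hd)⟩ * ⟨d, hd⟩ := Subtype.ext (by simp)
        rw [this, map_mul (Θ t), hΘM t _ (hcomm d hd), one_mul]
      have hVS : V ≤ S := by
        rw [← hgen]
        exact sup_le hV'S ((Subgroup.zpowers_le).mpr hσS)
      intro g hg d hd
      have h := (hVS hg).2 d hd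
      rw [hT _ (hconjV' g hg d hd), hT _ hd] at h
      exact Multiplicative.toAdd.injective h
    -- transport to `D ⊴ V` and extend via the transfer (trivial retraction, `P₁ = D`)
    let φ : Fin k → (D →ₜ* Multiplicative ℤ_[p]) := fun t => (Θ t).comp e
    have hφ : ∀ t (d : D), φ t d = Θ t (e d) := fun t d => rfl
    have hφinv : ∀ t (g : V) (d : D), φ t ⟨g * d * g⁻¹, hDn.conj_mem _ d.2 g⟩ = φ t d := by
      intro t g d
      rw [hφ, hφ, he, he]
      exact hinv t g g.2 ((d : V) : Γ) (Subgroup.mem_subgroupOf.mp d.2)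
    let r₀ : D →ₜ* V := ⟨1, continuous_const⟩
    have hr₀ : ∀ q : D, r₀ q = 1 := fun q => rfl
    have hext : ∀ t, ∃ Ψ : V →ₜ* Multiplicative ℤ_[p], ∀ d : D, Ψ d = φ t d ^ D.index :=
      fun t => exists_extension_pow_index (P := V) D D hDo le_rfl r₀
        (fun q => by rw [hr₀, inv_one, mul_one]; exact q.2) (fun q _ => hr₀ q) (φ t) (hφinv t)
    choose Ψ hΨ using hext
    -- on `V′`, `Ψ_t = [V : V′] · bden · w_t`
    have hΨw : ∀ t (x : V'),
        ((Multiplicative.toAdd (Ψ t ⟨x, hV'V x.2⟩) : ℤ_[p]) : ℚ_[p]) =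
          D.index * (bden * w t x) := by
      intro t x
      have hxD : (⟨x, hV'V x.2⟩ : V) ∈ D := by
        rw [hDdef, Subgroup.mem_subgroupOf]; exact x.2
      have h1 := hΨ t ⟨⟨x, hV'V x.2⟩, hxD⟩
      rw [Subgroup.coe_mk] at h1
      rw [h1, hφ, he, toAdd_pow, nsmul_eq_mul, PadicInt.coe_mul, PadicInt.coe_natCast, ← hΘw]
    have hΨind : LinearIndependent ℚ_[p]
        (fun (t : Fin k) (x : V) => ((Multiplicative.toAdd (Ψ t x) : ℤ_[p]) : ℚ_[p])) := by
      rw [Fintype.linearIndependent_iff]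
      intro g hg t
      have hrel : ∑ s, (g s * (D.index * bden)) • w s = 0 := by
        funext x
        have h1 := congrFun hg ⟨x, hV'V x.2⟩
        simp only [Finset.sum_apply, Pi.smul_apply, smul_eq_mul, hΨw, Pi.zero_apply] at h1 ⊢
        simpa [mul_assoc] using h1
      have h2 := (Fintype.linearIndependent_iff.mp hw) (fun s => g s * (D.index * bden)) hrel t
      exact (mul_eq_zero.mp h2).resolve_right (mul_ne_zero hf0 hbq)
    exact le_freeProlRank_of_linearIndependent (H := V) p Ψ hΨind
  -- assemble
  calc (N : ℕ∞) = (k : ℕ∞) + (r : ℕ∞) := by rw [hNkr]; push_cast; rfl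
    _ ≤ freeProlRank V p + freeProlRank M p := add_le_add hkV hrM

end Literature.AnabelianGeometry.AbsoluteAnabelian

end
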